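import Summits.BirchSwinnertonDyer.BirchSwinnertonDyer.Theorems.SignedLowerHalvesSmallImageLowerHalfBothSignsRttD2SeqJ3HJv
import Summits.BirchSwinnertonDyer.BirchSwinnertonDyer.Theorems.SignedLowerHalvesSmallImageLowerHalfBothSignsRttD2SeqJ3HPerf
import Literature.NumberTheory.GaloisRepresentations.TateDualUnramified
import HarnessLib

/-!
# Route `SignedLowerHalves`, crux L `SmallImageLowerHalfBothSigns` (stmt-BirchSwinnertonDyer-23599), line `rtt_w3` v21 → v22 — E2, row J3 = stub S2 of the v22 design:
# ★★★ `Function.Exact (jv ∘ₗ B′.subtype) gX` FOR EVERY PINNED `jv`, for the LEAD's `M = Cofree θ F`, with the perfectness input `hperf` DISCHARGED down to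
# `θ′|_{N_P} = 1` and the perfectness of `λ mod p^m` — no `RSeq`, no `hsolL`, no `hH0`, no `S₀ ⊆ P`, no `hperf`

WIDTH seat `bsd-line-slh-p3-w3` g24 under LEAD `cruxlead-stmt-BirchSwinnertonDyer-23599` g12 (cell `bsd-ssimc`); helper `--supports stmt-BirchSwinnertonDyer-23599`.
THEOREMS ONLY (no definition, no named fact, no instance, no `sorry`). HONEST FRAMING: assembly of H7e (`exact_junctionMap_comp_subtype_cofree_lam_free`, pinned-`jv`
form of J3) with H7d (`bijective_flip_cofreeLamCoeffPairingK`, perfectness from (i)+(ii)); the `μ`-half of (i) — `N_P` fixes `μ_{p^∞}` — is PROVED here from «every place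
above `p` lies in `P`» (inertia at `w ∤ p` fixes `μ_{p^m}`, tree `mu_apply_eq_self_of_mem_inertia`; `N_P` is the CLOSED normal closure of those inertia groups and the
kernel of the action on the finite discrete `μ_{p^m}` is closed and normal). REMAINING HYPOTHESES of S2: `[IsTotallyComplex K]`; `hinst`; `hpv`/`hvp`; `hv`; `hvP`, `hvS₀`,
`hPS₀`, `hP`/`hS₀` finite; `hNP`; `hMP`; `htor`; `hγB`; `hstabK`/`hstab`; `hθ` (`θ′θ = 1`); `hθN : θ′|_{N_P} = 1`; and the `λ`-PERFECTNESS `hlamInj`/`hlamSurj` (junction hand's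
choice of `lam`: `Tr_{𝒪/ℤ_p}` for unramified `𝒪`). E2, crux L, crux M, BSD remain OPEN and are proved for NO curve.

* ★ `mu_apply_eq_self_of_mem_ramificationSubgroup` — `N_P` fixes `μ_{p^m}(K̄)` when every place above `p` lies in `P`.
* ★★★ `exact_junctionMap_comp_subtype_cofree_lam_of_lamPerfect` — S2 for `M = Cofree θ F` modulo frame + `λ`-perfectness.
References: [Kobayashi2003] Thm. 7.3 i); [Rubin2000] Thm. 1.7.3, §4.2; [NeukirchSchmidtWingberg2008] VIII §3, (7.2.6); [SerreAbelianLadic1968] Ch. I §1.2; [Kato2004Asterisque] §17.13.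
-/

set_option autoImplicit false
set_option linter.dupNamespace false -- D-0017: single-problem summit, the namespace repeats the problem name by design
noncomputable section

open scoped Classical
open NumberField IsDedekindDomain Field Matrix CategoryTheory Function

namespace Summit.BirchSwinnertonDyer.BirchSwinnertonDyer.Theorems.SmallImageRttD2Seq

open Literature.NumberTheory.EllipticCurves Literature.NumberTheory.EllipticCurves.GreenbergSelmer Literature.NumberTheory.GaloisRepresentations
  Literature.NumberTheory.GaloisRepresentations.DiscreteGaloisModule Literature.NumberTheory.GaloisCohomology
  Literature.NumberTheory.EllipticCurves.GreenbergVatsal2000 Literature.NumberTheory.ComplexMultiplication.EllipticUnits.JohnsonLeungKings2011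
  Summit.BirchSwinnertonDyer.BirchSwinnertonDyer.Theorems.SmallImageCharSignedSelmer Summit.BirchSwinnertonDyer.BirchSwinnertonDyer.Theorems.SmallImageRttD2J1

/-! ## §1. `N_P` fixes `μ_{p^∞}` when every place above `p` lies in `P` -/

section Mu

variable {K : Type} [Field K] [NumberField K] {p : ℕ} [Fact p.Prime] (P : Set (HeightOneSpectrum (𝓞 K)))

/-- ★ **`N_P` fixes `μ_{p^m}(K̄)`** when every place of `K` above `p` lies in `P`: the inertia groups at `w ∉ P` (so `w ∤ p`) fix `μ_{p^m}` (the cyclotomic character is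
unramified away from `p`), and the kernel of the action of `Γ_K` on the finite discrete module `μ_{p^m}` is a CLOSED NORMAL subgroup, hence contains the closed normal
closure `N_P` of those inertia groups. [cite: SerreAbelianLadic1968, Ch. I §1.2] [cite: NeukirchSchmidtWingberg2008, VIII §3] -/
theorem mu_apply_eq_self_of_mem_ramificationSubgroup (hP : ∀ w : HeightOneSpectrum (𝓞 K), w ∉ P → ((p : ℕ) : 𝓞 K) ∉ w.asIdeal) (m : ℕ)
    {g : absoluteGaloisGroup K} (hg : g ∈ ramificationSubgroup K P) (ζ : MuCarrier K (p ^ m)) : mu K (p ^ m) g ζ = ζ := by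
  -- the kernel of the action, a closed normal subgroup
  let N : Subgroup (absoluteGaloisGroup K) := (mu K (p ^ m)).toRepresentation.ker
  have hNmem : ∀ σ : absoluteGaloisGroup K, σ ∈ N ↔ ∀ ξ : MuCarrier K (p ^ m), mu K (p ^ m) σ ξ = ξ := by
    intro σ
    rw [MonoidHom.mem_ker]
    constructor
    · intro h ξ
      have h' := LinearMap.congr_fun h ξ
      rw [ContinuousRep.toRepresentation_apply] at h'
      exact h'
    · intro h
      refine LinearMap.ext fun ξ ↦ ?_
      rw [ContinuousRep.toRepresentation_apply]
      exact h ξ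
  have hclosed : IsClosed (N : Set (absoluteGaloisGroup K)) := by
    have hset : (N : Set (absoluteGaloisGroup K)) = ⋂ ξ : MuCarrier K (p ^ m), (fun σ : absoluteGaloisGroup K ↦ mu K (p ^ m) σ ξ) ⁻¹' {ξ} := by
      ext σ
      rw [SetLike.mem_coe, hNmem, Set.mem_iInter]
      simp only [Set.mem_preimage, Set.mem_singleton_iff]
    rw [hset]
    exact isClosed_iInter fun ξ ↦ isClosed_singleton.preimage ((mu K (p ^ m)).continuous_apply_left ξ)
  have hle : ramificationSubgroup K P ≤ N := by
    refine Subgroup.topologicalClosure_minimal _ ?_ hclosed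
    refine Subgroup.normalClosure_le_normal fun τ hτ ↦ ?_
    rw [mem_inertiaOutside_iff] at hτ
    obtain ⟨w, hw, 𝔓, h𝔓, hτ⟩ := hτ
    exact (hNmem τ).mpr fun ξ ↦ mu_apply_eq_self_of_mem_inertia (hP w hw) h𝔓 hτ m ξ
  exact (hNmem g).mp (hle hg) ζ

end Mu

/-! ## §2. S2 for `M = Cofree θ F` modulo frame + `λ`-perfectness -/

section Cofree

variable {K : Type} [Field K] [NumberField K] {p : ℕ} [Fact p.Prime] {κ : ZpExtension K p} {γ : absoluteGaloisGroup K}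
  (S : Set (PadicAlgCl p)) [FiniteDimensional ℚ_[p] (padicCoeffField S)] (lam : padicCoeffIntegers S →+ ℤ_[p])
  (hlam : ∀ (c : ℤ_[p]) (y : padicCoeffIntegers S), lam (padicIntToCoeffIntegers S c * y) = c * lam y)
  (θ : FramedGaloisRep K (padicCoeffIntegers S) 1)
  {V : WeierstrassCurve K} {j : V.geomPrimaryTorsion p →+ Cofree θ (padicCoeffField S)} {S₀ : Set (HeightOneSpectrum (𝓞 K))} {ε : ℤˣ}
  (D : SignedTransportDualDataSat κ γ (Cofree θ (padicCoeffField S)) (padicCoeffIntegers S) V j S₀ ε)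
  {v : HeightOneSpectrum (𝓞 K)} [inst : DistribMulAction (absoluteGaloisGroup (v.adicCompletion K)) (Cofree θ (padicCoeffField S))]
  [SMulCommClass (absoluteGaloisGroup (v.adicCompletion K)) (padicCoeffIntegers S) (Cofree θ (padicCoeffField S))]
  {γv : absoluteGaloisGroup (v.adicCompletion K)} (DQ : LocalCondDualData κ (Cofree θ (padicCoeffField S)) (padicCoeffIntegers S) V j ε v γv)
  (hres : ∀ (σ : absoluteGaloisGroup (v.adicCompletion K)) (m : Cofree θ (padicCoeffField S)), σ • m = resGalOfEmb (closureEmb (K := K) (v.adicCompletion K)) σ • m)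
  (hvp : (p : 𝓞 K) ∈ v.asIdeal)
  {γB : absoluteGaloisGroup K} {θ' : absoluteGaloisGroup K →ₜ* (padicCoeffIntegers S)ˣ} {P : Set (HeightOneSpectrum (𝓞 K))}
  (I : CycIwasawaCohomologyDataO S κ γB θ' P 1)
  (hstab : ∀ m : Cofree θ (padicCoeffField S),
    IsOpen (MulAction.stabilizer (absoluteGaloisGroup (v.adicCompletion K)) m : Set (absoluteGaloisGroup (v.adicCompletion K))))
  (hθ : ∀ σ : absoluteGaloisGroup K,
    ((θ' σ : (padicCoeffIntegers S)ˣ) : padicCoeffIntegers S) * ((θ σ : GL (Fin 1) (padicCoeffIntegers S)) : Matrix (Fin 1) (Fin 1) (padicCoeffIntegers S)) 0 0 = 1)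
  (htor : ∀ m : Cofree θ (padicCoeffField S), ∃ k : ℕ, p ^ k • m = 0)
  (hγB : γB * resGalOfEmb (closureEmb (K := K) (v.adicCompletion K)) γv ∈ κ.kerSubgroup)
  (hNP : ∀ n, ramificationSubgroup K P ≤ κ.layerSubgroup n) (hv : AcSigned.IsNonsplitIn κ v)

include hv in
/-- ★★★ **S2 OF THE v22 DESIGN FOR `M = Cofree θ F`, MODULO FRAME + `λ`-PERFECTNESS.** For every `jv : B = I.H →ₗ[Λ_𝒪] DQ.X` with the pin
`DQ.toDual (jv b) = (𝓛.towerPairing I).pairing hstab b` (`𝓛 = layerPairingOf … (cofreeLamCoeffPairing S lam hlam …) …`; it exists uniquely, H7e): `Function.Exact (jv ∘ₗ B′.subtype) gX`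
on the strict carrier `B′ = strictCarrier I (strictLevel S κ θ′ P S₀)`. Inputs beyond the frame: `θ′|_{N_P} = 1` (`hθN`) and the perfectness of `λ mod p^m` (`hlamInj`, `hlamSurj`);
`N_P` fixes `μ_{p^∞}` by §1 (every place above `p` is `v ∈ P`). [cite: Kobayashi2003, Thm. 7.3 i)] [cite: Rubin2000, Thm. 1.7.3, §4.2] [cite: NeukirchSchmidtWingberg2008, VIII §6, (7.2.6)]
[cite: Kato2004Asterisque, §17.13] -/
theorem exact_junctionMap_comp_subtype_cofree_lam_of_lamPerfect [IsTotallyComplex K]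
    (hinst : inst = localAction (closureEmb (K := K) (v.adicCompletion K)) (Cofree θ (padicCoeffField S)))
    (instX : Module (IwasawaAlgebraO S) D.X) (instQ : Module (IwasawaAlgebraO S) DQ.X)
    (hιX : ∀ (f : IwasawaAlgebra p) (x : D.X), (letI := instX; iwasawaToIwasawaO S f • x) = f • x)
    (hιQ : ∀ (f : IwasawaAlgebra p) (x : DQ.X), (letI := instQ; iwasawaToIwasawaO S f • x) = f • x)
    (hCX : ∀ (a : padicCoeffIntegers S) (x : D.X) (s : signedTransportSelmerInftySat κ (Cofree θ (padicCoeffField S)) (padicCoeffIntegers S) V j S₀ ε),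
      D.toDual (letI := instX; (PowerSeries.C a : IwasawaAlgebraO S) • x) s =
        D.toDual x ⟨GreenbergSelmer.scalarH1 κ.kerSubgroup (Cofree θ (padicCoeffField S)) a s,
          scalarH1_mem_signedTransportSelmerInftySat κ (Cofree θ (padicCoeffField S)) (padicCoeffIntegers S) V j S₀ ε a s.2⟩)
    (hCQ : ∀ (a : padicCoeffIntegers S) (x : DQ.X) (c : localCondInftySat κ (Cofree θ (padicCoeffField S)) (padicCoeffIntegers S) V j ε v),
      DQ.toDual (letI := instQ; (PowerSeries.C a : IwasawaAlgebraO S) • x) c = DQ.toDual x (scalarLocalSat κ (Cofree θ (padicCoeffField S)) (padicCoeffIntegers S) V j ε v a c))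
    (hstabK : ∀ m : Cofree θ (padicCoeffField S), IsOpen (MulAction.stabilizer (absoluteGaloisGroup K) m : Set (absoluteGaloisGroup K)))
    (hγ : κ.IsTopGenerator γ) (hγv : κ.IsTopGenerator (resGalOfEmb (closureEmb (K := K) (v.adicCompletion K)) γv)) (hP : P.Finite)
    (hS₀ : S₀.Finite) (hPS₀ : ∀ w ∈ P, w ∉ S₀ → w = v) (hpv : ∀ w : HeightOneSpectrum (𝓞 K), ((p : ℕ) : 𝓞 K) ∈ w.asIdeal → w = v)
    (hMP : ∀ w : HeightOneSpectrum (𝓞 K), w ∉ P → ∀ 𝔓 ∈ w.primesAbove, ∀ τ ∈ 𝔓.inertia (absoluteGaloisGroup K), ∀ m : Cofree θ (padicCoeffField S), τ • m = m)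
    (hvS₀ : v ∉ S₀) (hvP : v ∈ P) (hθN : ∀ g ∈ ramificationSubgroup K P, θ' g = 1)
    (hlamInj : ∀ (m : ℕ) (t : padicCoeffIntegers S), (∀ b : padicCoeffIntegers S, lamZMod S lam m (b * t) = 0) →
      t ∈ Ideal.span {((p : ℕ) : padicCoeffIntegers S) ^ m})
    (hlamSurj : ∀ (m : ℕ) (g : padicCoeffIntegers S →+ ZMod (p ^ m)), ∃ t : padicCoeffIntegers S, ∀ b : padicCoeffIntegers S, g b = lamZMod S lam m (b * t))
    (jv : letI := instQ; I.H →ₗ[IwasawaAlgebraO S] DQ.X)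
    (hjv : ∀ b : I.H, DQ.toDual (jv b) =
      ((layerPairingOf S κ θ' P v (Cofree θ (padicCoeffField S)) hstab (cofreeLamCoeffPairing S lam hlam θ' P v θ hres hstab hθ) htor γB γv hγB hNP hv
        (cofreeLamCoeffPairing_hPred S lam hlam θ' P v θ hres hstab hθ) (cofreeLamCoeffPairing_hPsc S lam hlam θ' P v θ hres hstab hθ)).towerPairing I).pairing hstab b) :
    letI := instX; letI := instQ
    Function.Exact (jv ∘ₗ (strictCarrier I (strictLevel S κ θ' P S₀) (fun n k f _ hy ↦ smul_mem_strictLevel S κ θ' P S₀ γB n k f hy)).subtype)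
      (gXLinearMapO S D DQ hres hvp instX instQ hιX hιQ hCX hCQ htor hstabK hstab hγ hv hγv) := by
  have hPp : ∀ w : HeightOneSpectrum (𝓞 K), w ∉ P → ((p : ℕ) : 𝓞 K) ∉ w.asIdeal := fun w hw hpw ↦ hw (hpv w hpw ▸ hvP)
  exact exact_junctionMap_comp_subtype_cofree_lam_free S lam hlam θ D DQ hres hvp I hstab hθ htor hγB hNP hv hinst instX instQ hιX hιQ hCX hCQ hstabK hγ hγv hP hS₀ hPS₀
    hpv hMP hvS₀ hvP
    (fun m ↦ bijective_flip_cofreeLamCoeffPairingK S lam hlam θ' P θ hstabK hθ m hθN (fun g hg ζ ↦ mu_apply_eq_self_of_mem_ramificationSubgroup P hPp m hg ζ)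
      (hlamInj m) (hlamSurj m)) jv hjv

end Cofree

end Summit.BirchSwinnertonDyer.BirchSwinnertonDyer.Theorems.SmallImageRttD2Seq

end
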